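import Mathlib
import Summits.HodgeConjecture.HodgeConjecture.Theorems.HeckePrymWeilWeilSixfoldsSqrtMinus7SplittingArithmeticCore
import Literature.AlgebraicGeometry.Motives.WeilHermitianSplitting
import HarnessLib

/-!
# Route HeckePrymWeil · crux `WeilSixfoldsSqrtMinus7` (stmt-HodgeConjecture-1260) · line
# `real-quadratic-base-change` · stub 2a `stub_splittingArithmetic` — CLOSED

The arithmetic of the SPLITTING step of the line (van Geemen, LNM 1594, Lemma 5.2 (3), 5.4;
Markman, arXiv:2509.23079, Lemma 8.3.4 (2) = Deligne–Milne; Landherr): from the rational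
degree-one model `(M, G)` of a `ℚ(√-7)`-Weil-type `(A, φ, h_A)` WITH its signature `(6,6)` (the
output format of line 1's G3 `stub_weilSignature`) produce a positive NON-SQUARE `t` and twelve
`ℚ`-independent vectors of `ℚ¹² ⊕ ℚ¹²` spanning a subspace stable under `M ⊕ M` and under
`Ψ_t = (0 1; t·1 0)`, totally isotropic for `tG ⊕ G` — i.e. the base change `A ⊗ O_{ℚ(√t)}` is of
split `L`-Weil type, `L = ℚ(√-7, √t)`.

Proof. `K = ℚ[M]` acts on `V = ℚ¹²` (`Motives.exists_module_smul_eq`), `E = G` is an alternating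
Weil form of signature `(3,3)` over `K`; the tree's pre-splitting (`Motives.exists_weil_presplitting`,
Meyer twice) gives a totally isotropic `K`-plane `L_A` and an `H`-orthogonal anisotropic pair `p ⊥ q`,
`S(p) > 0 > S(q)`, orthogonal to `L_A`. Replacing `p` by `(1+α)/2 · p` if necessary (norm `2`),
`c = -S(q)/S(p) > 0` is NOT a rational square; write `c = N/D` and take `t = N D`, `r = 1/D`
(`t r² = c`, `t` non-square). The aiming relation `t r² S(p) + S(q) = 0` feeds the rational core
`exists_splitSubspace_aux` (file `…SplittingArithmeticCore`): `U = (L_A × L_A) ⊕ ⟨(rp,q), …⟩ ⊆ V × V`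
has dimension `12`, is `(J ⊕ J)`- and `Ψ_t`-stable and `tE ⊕ E`-isotropic; a `ℚ`-basis of `U`, read
in `ℚ¹² ⊕ ℚ¹²` through `Sum.elim`, is the frame. VERBATIM the registered stub `stub_splittingArithmetic`
of the skeleton `Lines/real_quadratic_base_change.lean` (lead c2 reshape r1, 2026-08-16).
-/

noncomputable section

-- single-problem summit (Problem = Summit): the mandated namespace repeats `HodgeConjecture`.
set_option linter.dupNamespace false

open Module
open Literature.AlgebraicGeometry.Motives

namespace Summit.HodgeConjecture.HodgeConjecture.Theorems.WeilSixfoldsSqrtMinus7.RealQuadraticBaseChange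

/-! ### Two rational-arithmetic lemmas -/

/-- If `c ≠ 0` is a rational square then `c / 2` is not (`2` is not a square in `ℚ`). [folklore] -/
theorem not_isSquare_div_two {c : ℚ} (hc : c ≠ 0) (h : IsSquare c) : ¬ IsSquare (c / 2) := by
  rintro ⟨u, hu⟩
  obtain ⟨s, hs⟩ := h
  have hu0 : u ≠ 0 := by
    rintro rfl
    rw [mul_zero, div_eq_zero_iff] at hu
    norm_num at hu
    exact hc hu
  have h2 : IsSquare (2 : ℚ) := ⟨s / u, by field_simp; linear_combination hs - 2 * hu⟩
  rw [show (2 : ℚ) = ((2 : ℕ) : ℚ) by norm_num, Rat.isSquare_natCast_iff] at h2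
  obtain ⟨k, hk⟩ := h2
  have hk2 : k ≤ 2 := by nlinarith
  interval_cases k <;> omega

/-- A positive rational `c` which is not a square is `t · r²` for a positive NON-SQUARE natural
number `t` and a rational `r ≠ 0` (`c = N/D` in lowest terms: `t = N D`, `r = 1/D`). [folklore] -/
theorem exists_nat_nonsquare_mul_sq_eq {c : ℚ} (hc : 0 < c) (hns : ¬ IsSquare c) :
    ∃ (t : ℕ) (r : ℚ), 0 < t ∧ ¬ IsSquare t ∧ r ≠ 0 ∧ (t : ℚ) * r ^ 2 = c := by
  have hnum : 0 < c.num := Rat.num_pos.2 hc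
  have hden : (0 : ℚ) < c.den := Nat.cast_pos.2 c.den_pos
  have hcd : (c.num : ℚ) = c * c.den := (Rat.mul_den_eq_num c).symm
  have hcast : ((c.num.natAbs * c.den : ℕ) : ℚ) = c * c.den * c.den := by
    rw [Nat.cast_mul, Nat.cast_natAbs, Int.cast_abs, abs_of_pos (Int.cast_pos.2 hnum), hcd]
  refine ⟨c.num.natAbs * c.den, 1 / c.den, ?_, ?_, by positivity, ?_⟩
  · exact Nat.mul_pos (Int.natAbs_pos.2 hnum.ne') c.den_pos
  · -- `t = c · den²` is a square iff `c` is
    intro ht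
    apply hns
    rw [← Rat.isSquare_natCast_iff, hcast] at ht
    obtain ⟨s, hs⟩ := ht
    refine ⟨s / c.den, ?_⟩
    field_simp
    linear_combination hs
  · rw [hcast]
    field_simp

/-! ### The stub -/

/-- **Stub 2a `stub_splittingArithmetic`, CLOSED** (lead c2's own stub of line
`real-quadratic-base-change`; Landherr for the relative hermitian form `H_A ⊗_K L`, made explicit —
see the module docstring for the proof). [cite: vanGeemen1994HodgeAV, Lemma 5.2 (3) and 5.4 (5.4.1)]
[cite: Markman2025SecantRealMultiplication, Lemma 8.3.4 (2)] -/
theorem stub_splittingArithmetic :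
    ∀ (M G : Matrix (Fin 12) (Fin 12) ℚ),
      (∀ v, M.mulVec (M.mulVec v) = -((7 : ℚ) • v)) →
      (∀ x y : Fin 12 → ℚ, y ⬝ᵥ G.mulVec x = -(x ⬝ᵥ G.mulVec y)) →
      (∀ x y : Fin 12 → ℚ, M.mulVec x ⬝ᵥ G.mulVec (M.mulVec y) = 7 * (x ⬝ᵥ G.mulVec y)) →
      (∃ P N : Submodule ℚ (Fin 12 → ℚ),
        (∀ v ∈ P, M.mulVec v ∈ P) ∧ (∀ v ∈ N, M.mulVec v ∈ N) ∧
        Module.finrank ℚ P = 6 ∧ Module.finrank ℚ N = 6 ∧ P ⊓ N = ⊥ ∧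
        (∀ x ∈ P, x ≠ 0 → 0 < x ⬝ᵥ G.mulVec (M.mulVec x)) ∧
        (∀ x ∈ N, x ≠ 0 → x ⬝ᵥ G.mulVec (M.mulVec x) < 0)) →
      ∃ (t : ℕ) (b : Fin 12 → (Fin 12 ⊕ Fin 12) → ℚ), 0 < t ∧ ¬ IsSquare t ∧ LinearIndependent ℚ b ∧
        (∀ k, ∃ c : Fin 12 → ℚ, (Matrix.fromBlocks M 0 0 M).mulVec (b k) = ∑ l, c l • b l) ∧
        (∀ k, ∃ c : Fin 12 → ℚ,
          (Matrix.fromBlocks (0 : Matrix (Fin 12) (Fin 12) ℚ) 1 ((t : ℚ) • (1 : Matrix (Fin 12) (Fin 12) ℚ)) 0).mulVec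
            (b k) = ∑ l, c l • b l) ∧
        ∀ k l, ∑ s, ∑ s', b k s * (Matrix.fromBlocks ((t : ℚ) • G) 0 0 G) s s' * b l s' = 0 := by
  intro M G hM2 hGt hGM hPN
  classical
  have hd : (0 : ℚ) < 7 := by norm_num
  -- the quadratic field `K = ℚ(√-7)` and the `K`-structure on `V = ℚ¹²` with `α` acting as `M`
  obtain ⟨K, _, _, α, hα, hK⟩ := exists_quadraticField 7 hd
  haveI : Module.Finite ℚ K := Module.Finite.of_basis (basisOneAlpha hd hα hK)
  obtain ⟨inst, hinst⟩ := exists_module_smul_eq (V := Fin 12 → ℚ) hd hα hK (Matrix.mulVecLin M)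
    (fun v => by rw [Matrix.mulVecLin_apply, Matrix.mulVecLin_apply]; exact hM2 v)
  letI : Module K (Fin 12 → ℚ) := inst
  haveI : IsScalarTower ℚ K (Fin 12 → ℚ) := hinst.1
  have hαM : ∀ v : Fin 12 → ℚ, α • v = M.mulVec v := fun v => by
    rw [hinst.2 v, Matrix.mulVecLin_apply]
  haveI : Module.Finite K (Fin 12 → ℚ) := Module.Finite.of_restrictScalars_finite ℚ K (Fin 12 → ℚ)
  have hV : Module.finrank K (Fin 12 → ℚ) = 2 * 3 := by
    have h := two_mul_finrank_eq_of_weilOperator (V := Fin 12 → ℚ) hd hα hK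
    rw [Module.finrank_fintype_fun_eq_card, Fintype.card_fin] at h
    omega
  -- the alternating Weil form `E = G`
  set E : LinearMap.BilinForm ℚ (Fin 12 → ℚ) := Matrix.toBilin' G with hEdef
  have hEapp : ∀ x y : Fin 12 → ℚ, E x y = x ⬝ᵥ G.mulVec y := fun x y => Matrix.toBilin'_apply' G x y
  have hE : ∀ x y : Fin 12 → ℚ, E x y = -E y x := fun x y => by rw [hEapp, hEapp, hGt]
  have hW : ∀ x y : Fin 12 → ℚ, E (α • x) (α • y) = 7 * E x y := fun x y => by
    rw [hEapp, hEapp, hαM, hαM, hGM]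
  -- the signature data over `K`
  have hPN' : ∃ P N : Submodule K (Fin 12 → ℚ), Module.finrank K P = 3 ∧ Module.finrank K N = 3 ∧
      P ⊓ N = ⊥ ∧ (∀ x ∈ P, x ≠ 0 → 0 < E x (α • x)) ∧ (∀ x ∈ N, x ≠ 0 → E x (α • x) < 0) := by
    obtain ⟨P, N, hP, hN, hPf, hNf, hPN0, hpos, hneg⟩ := hPN
    obtain ⟨P', hP'⟩ := exists_restrictScalars_eq_of_stable hd hα hK (Matrix.mulVecLin M)
      hinst.2 P (fun v hv => by simpa using hP v hv)
    obtain ⟨N', hN'⟩ := exists_restrictScalars_eq_of_stable hd hα hK (Matrix.mulVecLin M)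
      hinst.2 N (fun v hv => by simpa using hN v hv)
    refine ⟨P', N', ?_, ?_, inf_eq_bot_of_restrictScalars (by rw [hP', hN', hPN0]), ?_, ?_⟩
    · have h := two_mul_finrank_submodule_eq (V := Fin 12 → ℚ) hd hα hK P'
      rw [hP', hPf] at h
      omega
    · have h := two_mul_finrank_submodule_eq (V := Fin 12 → ℚ) hd hα hK N'
      rw [hN', hNf] at h
      omega
    · intro x hx hx0
      have hx' : x ∈ P := by rw [← hP']; exact hx
      rw [hEapp, hαM]
      exact hpos x hx' hx0
    · intro x hx hx0
      have hx' : x ∈ N := by rw [← hN']; exact hx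
      rw [hEapp, hαM]
      exact hneg x hx' hx0
  -- pre-splitting: `V ⊇ L_A ⊥ ⟨p⟩ ⊥ ⟨q⟩`, `L_A` totally isotropic of `K`-dimension 2
  obtain ⟨LA, p, q, hLAf, hLL, hLp, hLq, hpq, hp, hq⟩ :=
    exists_weil_presplitting hd hα hK 3 (by norm_num) (Fin 12 → ℚ) hV E hE hW hPN'
  -- adjust `p` within `K p` so that `-S(q)/S(p)` is not a rational square
  obtain ⟨p', hLp', hp'q, hp', hnsq⟩ : ∃ p' : Fin 12 → ℚ, (∀ x ∈ LA, weilHermitianForm E α p' x = 0) ∧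
      weilHermitianForm E α p' q = 0 ∧ 0 < E p' (α • p') ∧
      ¬ IsSquare (-(E q (α • q)) / E p' (α • p')) := by
    by_cases hsq : IsSquare (-(E q (α • q)) / E p (α • p))
    · refine ⟨(algebraMap ℚ K (1 / 2) + algebraMap ℚ K (1 / 2) * α) • p,
        fun x hx => weilHermitianForm_smul_left_eq_zero E hd hα hK hW (hLp x hx) _,
        weilHermitianForm_smul_left_eq_zero E hd hα hK hW hpq _, ?_, ?_⟩
      · rw [weilQ_smul E hα hE hW]
        norm_num
        exact hp
      · rw [weilQ_smul E hα hE hW]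
        have hc : -(E q (α • q)) / E p (α • p) ≠ 0 :=
          div_ne_zero (neg_ne_zero.2 hq.ne) hp.ne'
        have h := not_isSquare_div_two hc hsq
        convert h using 2
        norm_num
        ring
    · exact ⟨p, hLp, hpq, hp, hsq⟩
  -- the rational data for the core
  set J : (Fin 12 → ℚ) →ₗ[ℚ] (Fin 12 → ℚ) := Matrix.mulVecLin M with hJdef
  have hJα : ∀ v, J v = α • v := fun v => by rw [hαM]; rfl
  have hJ : ∀ v, J (J v) = -((7 : ℚ) • v) := fun v => by
    rw [hJdef, Matrix.mulVecLin_apply, Matrix.mulVecLin_apply]; exact hM2 v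
  have hJE : ∀ x y, E (J x) y = -E x (J y) := fun x y => by
    rw [hJα, hJα, apply_smul_left_of_weil E hd.ne' hα hW]
  set L : Submodule ℚ (Fin 12 → ℚ) := LA.restrictScalars ℚ with hLdef
  have hLJ : ∀ x ∈ L, J x ∈ L := fun x hx => by
    rw [hJα]; exact LA.smul_mem α hx
  have hLiso : ∀ x ∈ L, ∀ y ∈ L, E x y = 0 := fun x hx y hy =>
    apply_eq_zero_of_weilHermitianForm_eq_zero E hd hα (hLL x hx y hy)
  have hpL : ∀ x ∈ L, E p' x = 0 := fun x hx =>
    (apply_eq_zero_and_of_weilHermitianForm_eq_zero E hd hα (hLp' x hx)).2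
  have hpJL : ∀ x ∈ L, E p' (J x) = 0 := fun x hx => by
    rw [hJα]; exact (apply_eq_zero_and_of_weilHermitianForm_eq_zero E hd hα (hLp' x hx)).1
  have hqL : ∀ x ∈ L, E q x = 0 := fun x hx =>
    (apply_eq_zero_and_of_weilHermitianForm_eq_zero E hd hα (hLq x hx)).2
  have hqJL : ∀ x ∈ L, E q (J x) = 0 := fun x hx => by
    rw [hJα]; exact (apply_eq_zero_and_of_weilHermitianForm_eq_zero E hd hα (hLq x hx)).1
  have hpq' : E p' q = 0 := (apply_eq_zero_and_of_weilHermitianForm_eq_zero E hd hα hp'q).2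
  have hpJq' : E p' (J q) = 0 := by
    rw [hJα]; exact (apply_eq_zero_and_of_weilHermitianForm_eq_zero E hd hα hp'q).1
  have hp0 : E p' (J p') ≠ 0 := by rw [hJα]; exact hp'.ne'
  have hq0 : E q (J q) ≠ 0 := by rw [hJα]; exact hq.ne
  have hfinL : Module.finrank ℚ L = 4 := by
    have h := two_mul_finrank_submodule_eq (V := Fin 12 → ℚ) hd hα hK LA
    rw [hLAf] at h
    rw [hLdef, ← h]
  -- `t` and `r` with the aiming relation `t r² S(p') + S(q) = 0`
  have hcpos : 0 < -(E q (α • q)) / E p' (α • p') := div_pos (neg_pos.2 hq) hp'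
  obtain ⟨t, r, ht, htsq, hr, htr⟩ := exists_nat_nonsquare_mul_sq_eq hcpos hnsq
  have hstar : (t : ℚ) * r ^ 2 * E p' (J p') + E q (J q) = 0 := by
    rw [hJα, hJα, htr, div_mul_cancel₀ _ hp'.ne', neg_add_cancel]
  -- the rational core
  obtain ⟨U, hUf, hUJ, hUΨ, hUiso⟩ := exists_splitSubspace_aux J E hJ hE hJE L hLJ hLiso hpL hpJL hqL
    hqJL hpq' hpJq' hp0 hq0 hr hstar
  rw [hfinL] at hUf
  -- read a basis of `U` in `ℚ¹² ⊕ ℚ¹²`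
  have hUf' : Module.finrank ℚ U = 12 := by rw [hUf]
  haveI : FiniteDimensional ℚ U := FiniteDimensional.finiteDimensional_submodule U
  let bU := Module.finBasisOfFinrankEq ℚ U hUf'
  let Θ : ((Fin 12 → ℚ) × (Fin 12 → ℚ)) →ₗ[ℚ] (Fin 12 ⊕ Fin 12 → ℚ) :=
    (LinearEquiv.sumArrowLequivProdArrow (Fin 12) (Fin 12) ℚ ℚ).symm.toLinearMap
  have hΘ : ∀ u, Θ u = Sum.elim u.1 u.2 := fun u => rfl
  have hΘinj : Function.Injective Θ := (LinearEquiv.sumArrowLequivProdArrow _ _ ℚ ℚ).symm.injective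
  -- expanding `Θ` of a combination of the basis
  have hrepr : ∀ (z : (Fin 12 → ℚ) × (Fin 12 → ℚ)) (hz : z ∈ U),
      (∑ l, (bU.repr ⟨z, hz⟩ l) • Θ (bU l : (Fin 12 → ℚ) × (Fin 12 → ℚ))) = Θ z := by
    intro z hz
    have h := congrArg (fun w : U => Θ (w : (Fin 12 → ℚ) × (Fin 12 → ℚ))) (bU.sum_repr ⟨z, hz⟩)
    simpa only [Submodule.coe_sum, Submodule.coe_smul_of_tower, map_sum, map_smul] using h
  refine ⟨t, fun k => Θ (bU k : (Fin 12 → ℚ) × (Fin 12 → ℚ)), ht, htsq, ?_, ?_, ?_, ?_⟩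
  · -- independence
    exact bU.linearIndependent.map' (Θ ∘ₗ U.subtype)
      (LinearMap.ker_eq_bot.2 (hΘinj.comp Subtype.val_injective))
  · -- `M ⊕ M`-stability
    intro k
    dsimp only
    have hmem := hUJ _ (bU k).2
    refine ⟨fun l => bU.repr ⟨_, hmem⟩ l, ?_⟩
    rw [hrepr _ hmem, hΘ, hΘ, Matrix.fromBlocks_mulVec]
    simp only [Sum.elim_comp_inl, Sum.elim_comp_inr, Matrix.zero_mulVec, add_zero, zero_add]
    rfl
  · -- `Ψ_t`-stability
    intro k
    dsimp only
    have hmem := hUΨ _ (bU k).2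
    refine ⟨fun l => bU.repr ⟨_, hmem⟩ l, ?_⟩
    rw [hrepr _ hmem, hΘ, hΘ, Matrix.fromBlocks_mulVec]
    simp only [Sum.elim_comp_inl, Sum.elim_comp_inr, Matrix.zero_mulVec, add_zero, zero_add,
      Matrix.one_mulVec, Matrix.smul_mulVec]
  · -- isotropy
    intro k l
    dsimp only
    have h := hUiso _ (bU k).2 _ (bU l).2
    rw [hEapp, hEapp] at h
    have e : ∀ v v' : Fin 12 ⊕ Fin 12 → ℚ,
        ∑ s, ∑ s', v s * (Matrix.fromBlocks ((t : ℚ) • G) 0 0 G) s s' * v' s' =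
          v ⬝ᵥ (Matrix.fromBlocks ((t : ℚ) • G) 0 0 G).mulVec v' := by
      intro v v'
      simp only [dotProduct, Matrix.mulVec, Finset.mul_sum]
      refine Finset.sum_congr rfl fun s _ => Finset.sum_congr rfl fun s' _ => ?_
      ring
    rw [e, hΘ, hΘ, Matrix.fromBlocks_mulVec, Literature.AlgebraicGeometry.Motives.sumElim_dotProduct_sumElim]
    simp only [Sum.elim_comp_inl, Sum.elim_comp_inr, Matrix.zero_mulVec, add_zero, zero_add,
      Matrix.smul_mulVec, dotProduct_smul, smul_eq_mul]
    linear_combination h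

end Summit.HodgeConjecture.HodgeConjecture.Theorems.WeilSixfoldsSqrtMinus7.RealQuadraticBaseChange

end
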